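import Summits.CriticalPhenomena.PercolationContinuityZ3.Theorems.Transplant.SkelPhiKitsAHabStepIV
import Summits.CriticalPhenomena.PercolationContinuityZ3.Theorems.Transplant.SkelPhiRunKitClause
import Summits.CriticalPhenomena.PercolationContinuityZ3.Theorems.Transplant.SkelPhiParaRouteN
import HarnessLib

/-!
# N1 (the `{±1}` node), LEVEL 1, kit adapter file N-K7c: THE RUN-LEVEL KIT CLAUSES OVER A HABITAT — `kitClause_runXHab` / `kitClause_runYHab`
# (`kitClauseAHab'` at the run frames, as `kitClause_runX/Y`), and the route sets of a stride under a HABITAT weighting (`routeSetsN_xIn/_yIn`: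
# `routeSetsN_x/_y` with `IsSubbox (winGraphIn G Ω) Wt q Dr`, `Dr ⊆ Ω`) — the shapes the (C)/(F) residues read (`planarWindowIn`)

builds on p205010 (kernel theorem, internal audit signed; external expert review pending) — nothing in this file uses p205010; nothing here is a
claim about the open node `SamePDropOfSkeletonNeg`.
Lane `prim-bschramm`, seat `prim-bschramm-p1` (gen 11; design KIT-APRON-N1); helper file (`--supports stmt-CriticalPhenomena-4575 --as helper`).
* `routeSetsN_xIn`, `routeSetsN_yIn`; **`kitClause_runXHab`**, **`kitClause_runYHab`**.
[cite: KozmaNitzan2024, §4 Lemma 10, Steps III–IV (pp. 19–21)] [cite: MartineauTassion2017, §4.3 Lemma 4.2]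
-/

noncomputable section

open scoped Classical

namespace Summit.CriticalPhenomena.PercolationContinuityZ3.Theorems.Transplant

namespace Skelφ

open MeasureTheory ProbabilityTheory
open Literature.Probability.Percolation Literature.Probability.LatticeModels SimpleGraph KNLevels
open Literature.Barriers.CriticalPhenomena (graphBall graphBall_finite mem_graphBall_self graphBall_mono)
open Skel (winGraph winGraph_adj winGraph_le winGraphIn winGraphIn_le KitGeom)
open SkelI (tanOff tanTgt tanTgt_mem)
open Literature.Probability.Percolation.KozmaNitzan.Cells (oth oth_ne eq_oth_of_ne oth_oth)
open ChainPlanar ChainPara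

variable {V : Type} {G : SimpleGraph V} {φ : V → Site 2}

/-! ## §1 The route sets of a stride under a habitat weighting -/

/-- **THE ROUTE SETS OF AN x-STRIDE** (clause (iii) of the N1 route datum): `Qt := pgramPrismFin c n h (3ℓ) Rl`, `Ft :=` the side half of sign
`σ·τₖ` (`τₖ = steer k (runX c 1)`); `Ft ⊆ T`, `Qt ⊆ Dr`, `Ft` off the zone box, and the certificate at `c` transferred to the subbox weighting.
[cite: KozmaNitzan2024, §4 Lemma 10 Step IV (pp. 20–21), Lemma 11 (pp. 22–23)] [cite: MartineauTassion2017, §4.3 Lemma 4.2] -/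
theorem routeSetsN_xIn [DecidableEq V] [Countable V] [G.LocallyFinite] {n : ℕ} (hn : 1 ≤ n) (c₀ : V) (h : ℤ) {σ : ℤ} (hσ : σ = 1 ∨ σ = -1) (ℓ : ℕ)
    (R' qB N : ℕ) {w₀ c : V} {R r Rl k Mz : ℕ}
    (hc : runX φ c₀ n h σ c ∈ Finset.Icc ((xRunSched n ℓ h R' qB N).lo k - (((xRunSched n ℓ h R' qB N).R' : ℕ) : Site 2))
      ((xRunSched n ℓ h R' qB N).hi k + (((xRunSched n ℓ h R' qB N).R' : ℕ) : Site 2)))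
    (hcw : c ∈ graphBall G w₀ (R - r)) (hr : Rl ≤ r) (hrR : r ≤ R) {Z : Finset V} (hZ : (↑Z : Set V) ⊆ cyl φ c Mz) (hMz : Mz < n)
    {Dr T : Finset V} (hPD : Win G (runX φ c₀ n h σ) w₀ ((xRunSched n ℓ h R' qB N).region k) R ⊆ Dr)
    (hPT : Win G (runX φ c₀ n h σ) w₀ ((xRunSched n ℓ h R' qB N).core (k + 1)) R ⊆ T)
    {Ω : Finset V} (hDrΩ : Dr ⊆ Ω) {q : unitInterval} {Wt : Sym2 V → unitInterval} (hWD : IsSubbox (winGraphIn G Ω) Wt q Dr) {SEED : Finset V} {δ₂ : ℝ}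
    (hev : 1 - δ₂ < (bondPercolation G q).real (linkIn (pgramPrism G φ c n h (3 * ℓ) Rl) SEED
      (pgSideHalfW G φ c n h ℓ Rl σ (σ * (xPrmW n ℓ h R' qB N).steer k (runX φ c₀ n h σ c 1))))) :
    ∃ Qt Ft : Finset V, Ft ⊆ T ∧ Qt ⊆ Dr ∧ Disjoint Ft Z ∧ 1 - δ₂ < (prodBernoulli Wt).real (linkIn (↑Qt : Set V) SEED Ft) := by
  set τ₀ := (xPrmW n ℓ h R' qB N).steer k (runX φ c₀ n h σ c 1) with hτ₀
  have hQB : ∀ w ∈ pgramPrism G φ c n h (3 * ℓ) Rl, w ∈ graphBall G w₀ R := fun w hw =>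
    pgramPrism_subset_graphBall_of_mem hcw hr hrR n h (3 * ℓ) hw
  have hQD : pgramPrismFin G φ c n h (3 * ℓ) Rl ⊆ Dr := fun w hw => by
    have hw' := (mem_pgramPrismFin G φ).1 hw
    exact hPD ((mem_Win G _).2 ⟨hQB w hw', runX_mem_region_of_link hn c₀ h hσ R' qB N hc hw'⟩)
  refine ⟨pgramPrismFin G φ c n h (3 * ℓ) Rl, pgSideHalfW G φ c n h ℓ Rl σ (σ * τ₀), fun w hw => ?_, hQD, ?_, ?_⟩
  · -- `Ft ⊆ T`
    have hw' : w ∈ pgramPrism G φ c n h (3 * ℓ) Rl := coe_pgSideHalfW_subset (G := G) (φ := φ) c n h ℓ Rl σ _ (Finset.mem_coe.2 hw)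
    exact hPT ((mem_Win G _).2 ⟨hQB w hw', runX_mem_core_succ_of_piece hn c₀ h hσ R' qB N hc hw⟩)
  · -- `Ft` off the zone box
    have hd := disjoint_pgSideHalfW_cyl (G := G) (φ := φ) c hMz h ℓ Rl hσ (σ * τ₀)
    exact Finset.disjoint_left.2 fun w hw hz => Set.disjoint_left.1 hd (Finset.mem_coe.2 hw) (hZ (Finset.mem_coe.2 hz))
  · -- the certificate transferred to the subbox weighting of the window graph
    have hcoe : (↑(pgramPrismFin G φ c n h (3 * ℓ) Rl) : Set V) = pgramPrism G φ c n h (3 * ℓ) Rl := by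
      ext w; simp
    have heq := Skel.real_eq_of_isSubbox_of_le (winGraphIn_le G Ω) hWD hQD (Skel.adj_winGraphIn_of_subset (hQD.trans hDrΩ))
      (determinedBy_linkIn (↑(pgramPrismFin G φ c n h (3 * ℓ) Rl)) SEED (pgSideHalfW G φ c n h ℓ Rl σ (σ * τ₀)) subset_rfl)
      (measurableSet_linkIn _ _ _)
    rw [heq, hcoe]
    exact hev

/-- **THE ROUTE SETS OF A y′-STRIDE**: `Qt := pgramPrismFin c n h (3ℓ) Rl`, `Ft :=` the top piece `pgTopPieceW … σ τₖ v` (`τₖ = steer k (runY c 1)`),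
under the zone clearance `(Mz + 4)(n + |h|) ≤ n(ℓ + 1)`. (habitat weighting) [cite: KozmaNitzan2024, §4 Lemma 10 Step IV (pp. 20–21)] [cite: MartineauTassion2017, §4.3 Lemma 4.2] -/
theorem routeSetsN_yIn [DecidableEq V] [Countable V] [G.LocallyFinite] {n ℓ : ℕ} {h v : ℤ} (hn : 1 ≤ n) (hv : |v| ≤ n)
    (hlay : (n + h.natAbs : ℕ) ≤ (n : ℤ) * ℓ + 1) (c₀ : V) {σ : ℤ} (hσ : σ = 1 ∨ σ = -1) (R' qB N : ℕ) {w₀ c : V} {R r Rl k Mz : ℕ}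
    (hc : runY φ c₀ n h σ c ∈ Finset.Icc ((yRunSched hn hv hlay R' qB N).lo k - (((yRunSched hn hv hlay R' qB N).R' : ℕ) : Site 2))
      ((yRunSched hn hv hlay R' qB N).hi k + (((yRunSched hn hv hlay R' qB N).R' : ℕ) : Site 2)))
    (hcw : c ∈ graphBall G w₀ (R - r)) (hr : Rl ≤ r) (hrR : r ≤ R) {Z : Finset V} (hZ : (↑Z : Set V) ⊆ cyl φ c Mz)
    (hclear : (Mz + 4) * (n + h.natAbs) ≤ n * (ℓ + 1))
    {Dr T : Finset V} (hPD : Win G (runY φ c₀ n h σ) w₀ ((yRunSched hn hv hlay R' qB N).region k) R ⊆ Dr)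
    (hPT : Win G (runY φ c₀ n h σ) w₀ ((yRunSched hn hv hlay R' qB N).core (k + 1)) R ⊆ T)
    {Ω : Finset V} (hDrΩ : Dr ⊆ Ω) {q : unitInterval} {Wt : Sym2 V → unitInterval} (hWD : IsSubbox (winGraphIn G Ω) Wt q Dr) {SEED : Finset V} {δ₂ : ℝ}
    (hev : 1 - δ₂ < (bondPercolation G q).real (linkIn (pgramPrism G φ c n h (3 * ℓ) Rl) SEED
      (pgTopPieceW G φ c n h ℓ Rl σ ((yPrmW n ℓ h v R' qB N).steer k (runY φ c₀ n h σ c 1)) v))) :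
    ∃ Qt Ft : Finset V, Ft ⊆ T ∧ Qt ⊆ Dr ∧ Disjoint Ft Z ∧ 1 - δ₂ < (prodBernoulli Wt).real (linkIn (↑Qt : Set V) SEED Ft) := by
  set τ₀ := (yPrmW n ℓ h v R' qB N).steer k (runY φ c₀ n h σ c 1) with hτ₀
  have hQB : ∀ w ∈ pgramPrism G φ c n h (3 * ℓ) Rl, w ∈ graphBall G w₀ R := fun w hw =>
    pgramPrism_subset_graphBall_of_mem hcw hr hrR n h (3 * ℓ) hw
  have hQD : pgramPrismFin G φ c n h (3 * ℓ) Rl ⊆ Dr := fun w hw => by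
    have hw' := (mem_pgramPrismFin G φ).1 hw
    exact hPD ((mem_Win G _).2 ⟨hQB w hw', runY_mem_region_of_link hn hv hlay c₀ hσ R' qB N hc hw'⟩)
  refine ⟨pgramPrismFin G φ c n h (3 * ℓ) Rl, pgTopPieceW G φ c n h ℓ Rl σ τ₀ v, fun w hw => ?_, hQD, ?_, ?_⟩
  · have hw' : w ∈ pgramPrism G φ c n h (3 * ℓ) Rl := coe_pgTopPieceW_subset (G := G) (φ := φ) c n h ℓ Rl σ τ₀ v (Finset.mem_coe.2 hw)
    exact hPT ((mem_Win G _).2 ⟨hQB w hw', runY_mem_core_succ_of_piece hn hv hlay c₀ hσ R' qB N hc hw⟩)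
  · have hd := disjoint_pgTopPieceW_cyl (G := G) (φ := φ) c hn hclear Rl hσ τ₀ v
    exact Finset.disjoint_left.2 fun w hw hz => Set.disjoint_left.1 hd (Finset.mem_coe.2 hw) (hZ (Finset.mem_coe.2 hz))
  · have hcoe : (↑(pgramPrismFin G φ c n h (3 * ℓ) Rl) : Set V) = pgramPrism G φ c n h (3 * ℓ) Rl := by
      ext w; simp
    have heq := Skel.real_eq_of_isSubbox_of_le (winGraphIn_le G Ω) hWD hQD (Skel.adj_winGraphIn_of_subset (hQD.trans hDrΩ))
      (determinedBy_linkIn (↑(pgramPrismFin G φ c n h (3 * ℓ) Rl)) SEED (pgTopPieceW G φ c n h ℓ Rl σ τ₀ v) subset_rfl)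
      (measurableSet_linkIn _ _ _)
    rw [heq, hcoe]
    exact hev


/-! ## §2 The run-level kit clauses over a habitat -/

section Hab

variable [DecidableEq V] [G.LocallyFinite]

/-- **THE KIT CLAUSE OF AN x-RUN WINDOW LEVEL OVER A HABITAT** (`winGraphIn G Ω`, `Ω ⊇ winLevel`). Level box `[lo − j, hi + j]` of the frame `runX φ c₀ n_L h_L σ` around `w₀` (radius `R`);
kit constants `P` with the four placement numbers; short region `Rg`, zone family `Λc` (seed level `kz`, zone level `nz`), short piece data
`Q` (pieces inside `Rg`, exit inequalities); per contact: far ⇒ inner neighbour in the target; near ⇒ a face vertex in the target or the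
three Step-IV inputs at the kit centre (zone, the exit link of the side's piece, the route datum). [cite: KozmaNitzan2024, §4 Lemma 10] -/
theorem kitClause_runXHab [Countable V] {types : Finset V} (hlipφ : Lip G φ) (hstep : Steps G φ) (hfr : Frames G φ types) (hκ : CylConn G φ types)
    {Δ : ℕ} (hΔ : ∀ v, G.degree v ≤ Δ) {q : unitInterval} {δ : ℝ} (hδ : 0 < δ)
    -- the run frame
    {nL : ℕ} (hnL : 1 ≤ nL) (c₀ : V) (hL : ℤ) {σ : ℤ} (hσ : σ = 1 ∨ σ = -1) {kq : ℕ} (hκL : hL.natAbs ≤ kq * nL)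
    -- the level box and the window
    {lo hi : Site 2} {j : ℕ} {w₀ : V} {R : ℕ}
    -- kit constants
    (P : ApronPrm) {nz Rs Kmax KCmax rs cS cU : ℕ} (hPN : kq + 3 ≤ P.N) (hA : P.A = (nz + 1 : ℕ) * (shearUnit nL hL : ℤ) + 1)
    (hd1 : P.W + P.ℓ ≤ P.d) (hD1 : P.W + P.ℓ + P.d + 2 ≤ shellD P) (hD2 : P.ℓ + Rs + P.d + 3 ≤ shellD P) (hDρ : Rs + 1 ≤ shellD P)
    (hℓ : 1 ≤ P.ℓ) (hW : Rs + P.ℓ ≤ P.W) (hKmax : (shellD P + P.W) * (kq + 1) ≤ Kmax) (hKCmax : (shellD P + nz + 1) * (kq + 1) ≤ KCmax)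
    (hR' : cylRadMax G φ types P.ℓ (Rs + KCmax + (P.W + Kmax)) ≤ P.R')
    (hwide : ∀ i, (lo - (j : Site 2)) i + 2 * tanOff P.ℓs P.M ≤ (hi + (j : Site 2)) i)
    (hdw : ∀ i, (lo - (j : Site 2)) i + (P.d + 2 : ℕ) ≤ (hi + (j : Site 2)) i)
    (hDw : ∀ i, (lo - (j : Site 2)) i + ((shellD P + 1 + P.d + KCmax + Rs : ℕ) : ℤ) ≤ (hi + (j : Site 2)) i)
    (hT : (P.W : ℤ) + Kmax + P.ℓ + 1 ≤ tanOff P.ℓs P.M) (hT' : (shellD P : ℤ) + KCmax + Rs ≤ tanOff P.ℓs P.M)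
    (hr₀ : P.N * (tanOff P.ℓs P.M + 2) + P.N * P.d + (P.W + Kmax + P.R') + (KCmax + Rs) ≤ P.r₀) (hR : P.r₀ ≤ R)
    (hrs : 2 * (1 + P.N * (tanOff P.ℓs P.M + 2) + P.N * P.d + (P.W + Kmax + P.R') + (KCmax + Rs)) ≤ rs)
    (hcS : (P.N + 1) * (tanOff P.ℓs P.M + 1) + (P.N + 1) * P.d + (2 * P.W + 1) * (Kmax + 1) * (Δ + 1) ^ P.R' ≤ cS)
    -- the short region, the zone family, the short pieces
    (Rg : V → Finset V) (hRg : ∀ c, ∀ u ∈ Rg c, u ∈ graphBall G c Rs) (hRgcard : ∀ c, (Rg c).card ≤ cU) (hcU1 : 1 ≤ cU)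
    (Λc : V → ℕ → Finset V) (kz : ℕ) (hkn : ∀ c, Λc c kz ⊆ Λc c nz) (hΛ : ∀ c, ∀ v ∈ Λc c nz, v ∈ Rg c ∧ φ v - φ c ∈ box 2 nz)
    (Q : ShortPc V) (hQRg : ∀ i σ₀ c, pexX G φ Q σ i σ₀ c ⊆ Rg c) (hnS : ∀ c, 1 ≤ Q.nS c) (hexRaw : ∀ c, nz + 3 ≤ Q.nS c)
    (hexLev : ∀ c, (P.A + nL) * Q.nS c ≤
      (nL : ℤ) * ((Q.nS c : ℤ) * Q.ℓS c - shearUnit (Q.nS c) (Q.hS c) + 1) - |(nL : ℤ) * Q.hS c - hL * Q.nS c| * Q.nS c)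
    -- the level's source/support, the weighting, the region and the target
    {Ω : Finset V} (hfull : winLevel G (runX φ c₀ nL hL σ) w₀ R lo hi j ⊆ Ω)
    (k : ℕ) (o : V) (Sfin : Finset V) {Wt : Sym2 V → unitInterval} {D T : Finset V} (hWD : IsSubbox (winGraphIn G Ω) Wt q D)
    (hXD : winLevelIn (runX φ c₀ nL hL σ) Ω lo hi j ⊆ D) {N : ℕ} (hN : k * (Δ + 1) ^ (2 * rs) ≤ N)
    (hk : (1 - (q : ℝ) ^ (1 + Δ * cS + cS * cU)) ^ k ≤ δ)
    -- per contact
    (hpad : ∀ x ∈ outerBoundary (winGraphIn G Ω) (winLevelIn (runX φ c₀ nL hL σ) Ω lo hi j),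
      x ∉ outerBoundary (winGraph G w₀ R) (winLevel G (runX φ c₀ nL hL σ) w₀ R lo hi j) →
      inNbrIn G (runX φ c₀ nL hL σ) Ω (Finset.Icc (lo - (j : Site 2)) (hi + (j : Site 2))) x ∈ T)
    (hfar : ∀ x ∈ outerBoundary (winGraph G w₀ R) (winLevel G (runX φ c₀ nL hL σ) w₀ R lo hi j),
      ¬ IsNear G (runX φ c₀ nL hL σ) (lo - (j : Site 2)) (hi + (j : Site 2)) P w₀ R x →
      ctY G (runX φ c₀ nL hL σ) w₀ R (lo - (j : Site 2)) (hi + (j : Site 2)) x ∈ T)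
    (hnear' : ∀ x ∈ outerBoundary (winGraph G w₀ R) (winLevel G (runX φ c₀ nL hL σ) w₀ R lo hi j),
      IsNear G (runX φ c₀ nL hL σ) (lo - (j : Site 2)) (hi + (j : Site 2)) P w₀ R x →
      (∃ u ∈ ctFace G (runXSideU (φ := φ) c₀ hnL hL hσ (lo - (j : Site 2)) (hi + (j : Site 2))) Rg P w₀ R x, u ∈ T) ∨
      (1 - δ ^ 2 < (bondPercolation G q).real
          (UniqZone.zone G (Λc (ctCtr G (runXSideU (φ := φ) c₀ hnL hL hσ (lo - (j : Site 2)) (hi + (j : Site 2))) P w₀ R x)) kz nz) ∧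
        1 - δ ^ 2 < (bondPercolation G q).real
          (linkIn (↑(Rg (ctCtr G (runXSideU (φ := φ) c₀ hnL hL hσ (lo - (j : Site 2)) (hi + (j : Site 2))) P w₀ R x)) : Set V)
            (Λc (ctCtr G (runXSideU (φ := φ) c₀ hnL hL hσ (lo - (j : Site 2)) (hi + (j : Site 2))) P w₀ R x) kz)
            (pexX G φ Q σ (ctDir G (runX φ c₀ nL hL σ) w₀ R (lo - (j : Site 2)) (hi + (j : Site 2)) x).1
              (ctDir G (runX φ c₀ nL hL σ) w₀ R (lo - (j : Site 2)) (hi + (j : Site 2)) x).2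
              (ctCtr G (runXSideU (φ := φ) c₀ hnL hL hσ (lo - (j : Site 2)) (hi + (j : Site 2))) P w₀ R x))) ∧
        ∃ Qt Ft : Finset V, Ft ⊆ T ∧ Qt ⊆ D ∧
          Disjoint Ft (Λc (ctCtr G (runXSideU (φ := φ) c₀ hnL hL hσ (lo - (j : Site 2)) (hi + (j : Site 2))) P w₀ R x) nz) ∧
          1 - δ ^ 2 < (prodBernoulli Wt).real (linkIn (↑Qt : Set V)
            (Λc (ctCtr G (runXSideU (φ := φ) c₀ hnL hL hσ (lo - (j : Site 2)) (hi + (j : Site 2))) P w₀ R x) kz) Ft))) :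
    ∃ (σ' : SData V) (S : Finset V), SHyp (winLDataIn G (runX φ c₀ nL hL σ) Ω lo hi o Sfin) j σ' ∧ σ'.N ≤ N ∧
      (1 - (q : ℝ) ^ σ'.sB) ^ σ'.k ≤ δ ∧ S ⊆ (winLDataIn G (runX φ c₀ nL hL σ) Ω lo hi o Sfin).X j ∧ S ⊆ D ∧
      (∀ x ∈ σ'.K, ∀ e ∈ σ'.seed x, e ∉ wireSet (↑S : Set V)) ∧ (∀ x ∈ σ'.K, σ'.face x ⊆ S) ∧
      (∀ x ∈ σ'.K, 1 - 3 * δ ≤ (prodBernoulli Wt).real {ω | ∃ u ∈ σ'.face x,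
        1 - δ < (prodBernoulli (pinW Wt (wireSet (↑S : Set V)) ω)).real (⋃ t ∈ T, openConnIn (↑D : Set V) u t)}) := by
  set SF := runXSideU (φ := φ) c₀ hnL hL hσ (lo - (j : Site 2)) (hi + (j : Site 2)) with hSF
  have hU1 : (1 : ℤ) ≤ (shearUnit nL hL : ℤ) := by have := shearUnit_pos hnL hL; omega
  have hU : (shearUnit nL hL : ℤ) ≤ ((kq + 1 : ℕ) : ℤ) * nL := by
    unfold shearUnit; push_cast
    have : (hL.natAbs : ℤ) ≤ kq * nL := by exact_mod_cast hκL
    linarith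
  have haff : ∀ (i : Fin 2) (σ₀ : ℤˣ), (SF i σ₀).IsAffine (shearUnit nL hL : ℤ) (if i = 0 then (shearUnit nL hL : ℤ) else nL) := fun i σ₀ => by
    rw [hSF]; exact runXSideU_isAffine c₀ hnL hL hσ _ _ i σ₀
  have hC : ∀ (i : Fin 2) (σ₀ : ℤˣ), (nL : ℤ) ≤ (if i = 0 then (shearUnit nL hL : ℤ) else nL) := fun i σ₀ => by
    split_ifs
    · have : ((shearUnit nL hL : ℕ) : ℤ) = nL + (hL.natAbs : ℤ) := by unfold shearUnit; push_cast; ring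
      rw [this]; linarith [Int.natCast_nonneg hL.natAbs]
    · exact le_rfl
  have hA0 : 0 ≤ P.A := by rw [hA]; positivity
  have hdD : P.d + 2 ≤ shellD P := by omega
  have hr₀2 : 2 ≤ KCmax + Rs := by
    have : 2 ≤ shellD P := by unfold shellD; omega
    nlinarith [hKCmax]
  refine kitClauseAHab' SF Rg (lip_runX hlipφ hσ hnL c₀ hL) ((qStepsN_runX hstep hnL c₀ hL hσ hκL).mono hPN) hlipφ hstep hfr hκ hΔ hδ hℓ
    hwide hdw hdD hDw hDρ
    (hbelow_of_affine SF haff hU1 P hD1) (habove_of_affine SF haff hU1 P hd1) (hK_of_affine SF haff hU1 P hnL hC hU hKmax)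
    (fun i σ₀ z hz _ => hKC_of_affine SF haff hU1 P hnL hC hU hA hKCmax i σ₀ z hz) (hθA_of_affine SF haff hU1 P hA0 hdD) (hAz_of_affine SF haff P hA)
    (hcap_of_affine SF haff hU1 P hD2) (compat_runX hnL c₀ hL hσ) hT hT' hW hR' hRg hRgcard hcU1 hr₀ hr₀2 hR hrs hcS Λc hkn hΛ
    (pexX G φ Q σ) (fun i σ₀ c v hv => ⟨hQRg i σ₀ c hv, ?_⟩) hfull k o Sfin hWD hXD hN hk hpad hfar hnear'
  rw [hSF]
  exact pexX_spec c₀ hnL hL hσ _ _ Q hA hnS hexRaw hexLev i σ₀ c v hv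

/-- **THE KIT CLAUSE OF A y′-RUN WINDOW LEVEL OVER A HABITAT** (coordinates exchanged). Level box `[lo − j, hi + j]` of the frame `runX φ c₀ n_L h_L σ` around `w₀` (radius `R`);
kit constants `P` with the four placement numbers; short region `Rg`, zone family `Λc` (seed level `kz`, zone level `nz`), short piece data
`Q` (pieces inside `Rg`, exit inequalities); per contact: far ⇒ inner neighbour in the target; near ⇒ a face vertex in the target or the
three Step-IV inputs at the kit centre (zone, the exit link of the side's piece, the route datum). [cite: KozmaNitzan2024, §4 Lemma 10] -/
theorem kitClause_runYHab [Countable V] {types : Finset V} (hlipφ : Lip G φ) (hstep : Steps G φ) (hfr : Frames G φ types) (hκ : CylConn G φ types)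
    {Δ : ℕ} (hΔ : ∀ v, G.degree v ≤ Δ) {q : unitInterval} {δ : ℝ} (hδ : 0 < δ)
    -- the run frame
    {nL : ℕ} (hnL : 1 ≤ nL) (c₀ : V) (hL : ℤ) {σ : ℤ} (hσ : σ = 1 ∨ σ = -1) {kq : ℕ} (hκL : hL.natAbs ≤ kq * nL)
    -- the level box and the window
    {lo hi : Site 2} {j : ℕ} {w₀ : V} {R : ℕ}
    -- kit constants
    (P : ApronPrm) {nz Rs Kmax KCmax rs cS cU : ℕ} (hPN : kq + 3 ≤ P.N) (hA : P.A = (nz + 1 : ℕ) * (shearUnit nL hL : ℤ) + 1)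
    (hd1 : P.W + P.ℓ ≤ P.d) (hD1 : P.W + P.ℓ + P.d + 2 ≤ shellD P) (hD2 : P.ℓ + Rs + P.d + 3 ≤ shellD P) (hDρ : Rs + 1 ≤ shellD P)
    (hℓ : 1 ≤ P.ℓ) (hW : Rs + P.ℓ ≤ P.W) (hKmax : (shellD P + P.W) * (kq + 1) ≤ Kmax) (hKCmax : (shellD P + nz + 1) * (kq + 1) ≤ KCmax)
    (hR' : cylRadMax G φ types P.ℓ (Rs + KCmax + (P.W + Kmax)) ≤ P.R')
    (hwide : ∀ i, (lo - (j : Site 2)) i + 2 * tanOff P.ℓs P.M ≤ (hi + (j : Site 2)) i)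
    (hdw : ∀ i, (lo - (j : Site 2)) i + (P.d + 2 : ℕ) ≤ (hi + (j : Site 2)) i)
    (hDw : ∀ i, (lo - (j : Site 2)) i + ((shellD P + 1 + P.d + KCmax + Rs : ℕ) : ℤ) ≤ (hi + (j : Site 2)) i)
    (hT : (P.W : ℤ) + Kmax + P.ℓ + 1 ≤ tanOff P.ℓs P.M) (hT' : (shellD P : ℤ) + KCmax + Rs ≤ tanOff P.ℓs P.M)
    (hr₀ : P.N * (tanOff P.ℓs P.M + 2) + P.N * P.d + (P.W + Kmax + P.R') + (KCmax + Rs) ≤ P.r₀) (hR : P.r₀ ≤ R)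
    (hrs : 2 * (1 + P.N * (tanOff P.ℓs P.M + 2) + P.N * P.d + (P.W + Kmax + P.R') + (KCmax + Rs)) ≤ rs)
    (hcS : (P.N + 1) * (tanOff P.ℓs P.M + 1) + (P.N + 1) * P.d + (2 * P.W + 1) * (Kmax + 1) * (Δ + 1) ^ P.R' ≤ cS)
    -- the short region, the zone family, the short pieces
    (Rg : V → Finset V) (hRg : ∀ c, ∀ u ∈ Rg c, u ∈ graphBall G c Rs) (hRgcard : ∀ c, (Rg c).card ≤ cU) (hcU1 : 1 ≤ cU)
    (Λc : V → ℕ → Finset V) (kz : ℕ) (hkn : ∀ c, Λc c kz ⊆ Λc c nz) (hΛ : ∀ c, ∀ v ∈ Λc c nz, v ∈ Rg c ∧ φ v - φ c ∈ box 2 nz)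
    (Q : ShortPc V) (hQRg : ∀ i σ₀ c, pexY G φ Q σ i σ₀ c ⊆ Rg c) (hnS : ∀ c, 1 ≤ Q.nS c) (hexRaw : ∀ c, nz + 3 ≤ Q.nS c)
    (hexLev : ∀ c, (P.A + nL) * Q.nS c ≤
      (nL : ℤ) * ((Q.nS c : ℤ) * Q.ℓS c - shearUnit (Q.nS c) (Q.hS c) + 1) - |(nL : ℤ) * Q.hS c - hL * Q.nS c| * Q.nS c)
    -- the level's source/support, the weighting, the region and the target
    {Ω : Finset V} (hfull : winLevel G (runY φ c₀ nL hL σ) w₀ R lo hi j ⊆ Ω)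
    (k : ℕ) (o : V) (Sfin : Finset V) {Wt : Sym2 V → unitInterval} {D T : Finset V} (hWD : IsSubbox (winGraphIn G Ω) Wt q D)
    (hXD : winLevelIn (runY φ c₀ nL hL σ) Ω lo hi j ⊆ D) {N : ℕ} (hN : k * (Δ + 1) ^ (2 * rs) ≤ N)
    (hk : (1 - (q : ℝ) ^ (1 + Δ * cS + cS * cU)) ^ k ≤ δ)
    -- per contact
    (hpad : ∀ x ∈ outerBoundary (winGraphIn G Ω) (winLevelIn (runY φ c₀ nL hL σ) Ω lo hi j),
      x ∉ outerBoundary (winGraph G w₀ R) (winLevel G (runY φ c₀ nL hL σ) w₀ R lo hi j) →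
      inNbrIn G (runY φ c₀ nL hL σ) Ω (Finset.Icc (lo - (j : Site 2)) (hi + (j : Site 2))) x ∈ T)
    (hfar : ∀ x ∈ outerBoundary (winGraph G w₀ R) (winLevel G (runY φ c₀ nL hL σ) w₀ R lo hi j),
      ¬ IsNear G (runY φ c₀ nL hL σ) (lo - (j : Site 2)) (hi + (j : Site 2)) P w₀ R x →
      ctY G (runY φ c₀ nL hL σ) w₀ R (lo - (j : Site 2)) (hi + (j : Site 2)) x ∈ T)
    (hnear' : ∀ x ∈ outerBoundary (winGraph G w₀ R) (winLevel G (runY φ c₀ nL hL σ) w₀ R lo hi j),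
      IsNear G (runY φ c₀ nL hL σ) (lo - (j : Site 2)) (hi + (j : Site 2)) P w₀ R x →
      (∃ u ∈ ctFace G (runYSideU (φ := φ) c₀ hnL hL hσ (lo - (j : Site 2)) (hi + (j : Site 2))) Rg P w₀ R x, u ∈ T) ∨
      (1 - δ ^ 2 < (bondPercolation G q).real
          (UniqZone.zone G (Λc (ctCtr G (runYSideU (φ := φ) c₀ hnL hL hσ (lo - (j : Site 2)) (hi + (j : Site 2))) P w₀ R x)) kz nz) ∧
        1 - δ ^ 2 < (bondPercolation G q).real
          (linkIn (↑(Rg (ctCtr G (runYSideU (φ := φ) c₀ hnL hL hσ (lo - (j : Site 2)) (hi + (j : Site 2))) P w₀ R x)) : Set V)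
            (Λc (ctCtr G (runYSideU (φ := φ) c₀ hnL hL hσ (lo - (j : Site 2)) (hi + (j : Site 2))) P w₀ R x) kz)
            (pexY G φ Q σ (ctDir G (runY φ c₀ nL hL σ) w₀ R (lo - (j : Site 2)) (hi + (j : Site 2)) x).1
              (ctDir G (runY φ c₀ nL hL σ) w₀ R (lo - (j : Site 2)) (hi + (j : Site 2)) x).2
              (ctCtr G (runYSideU (φ := φ) c₀ hnL hL hσ (lo - (j : Site 2)) (hi + (j : Site 2))) P w₀ R x))) ∧
        ∃ Qt Ft : Finset V, Ft ⊆ T ∧ Qt ⊆ D ∧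
          Disjoint Ft (Λc (ctCtr G (runYSideU (φ := φ) c₀ hnL hL hσ (lo - (j : Site 2)) (hi + (j : Site 2))) P w₀ R x) nz) ∧
          1 - δ ^ 2 < (prodBernoulli Wt).real (linkIn (↑Qt : Set V)
            (Λc (ctCtr G (runYSideU (φ := φ) c₀ hnL hL hσ (lo - (j : Site 2)) (hi + (j : Site 2))) P w₀ R x) kz) Ft))) :
    ∃ (σ' : SData V) (S : Finset V), SHyp (winLDataIn G (runY φ c₀ nL hL σ) Ω lo hi o Sfin) j σ' ∧ σ'.N ≤ N ∧
      (1 - (q : ℝ) ^ σ'.sB) ^ σ'.k ≤ δ ∧ S ⊆ (winLDataIn G (runY φ c₀ nL hL σ) Ω lo hi o Sfin).X j ∧ S ⊆ D ∧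
      (∀ x ∈ σ'.K, ∀ e ∈ σ'.seed x, e ∉ wireSet (↑S : Set V)) ∧ (∀ x ∈ σ'.K, σ'.face x ⊆ S) ∧
      (∀ x ∈ σ'.K, 1 - 3 * δ ≤ (prodBernoulli Wt).real {ω | ∃ u ∈ σ'.face x,
        1 - δ < (prodBernoulli (pinW Wt (wireSet (↑S : Set V)) ω)).real (⋃ t ∈ T, openConnIn (↑D : Set V) u t)}) := by
  set SF := runYSideU (φ := φ) c₀ hnL hL hσ (lo - (j : Site 2)) (hi + (j : Site 2)) with hSF
  have hU1 : (1 : ℤ) ≤ (shearUnit nL hL : ℤ) := by have := shearUnit_pos hnL hL; omega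
  have hU : (shearUnit nL hL : ℤ) ≤ ((kq + 1 : ℕ) : ℤ) * nL := by
    unfold shearUnit; push_cast
    have : (hL.natAbs : ℤ) ≤ kq * nL := by exact_mod_cast hκL
    linarith
  have haff : ∀ (i : Fin 2) (σ₀ : ℤˣ), (SF i σ₀).IsAffine (shearUnit nL hL : ℤ) (if i = 0 then (nL : ℤ) else (shearUnit nL hL : ℤ)) := fun i σ₀ => by
    rw [hSF]; exact runYSideU_isAffine c₀ hnL hL hσ _ _ i σ₀
  have hC : ∀ (i : Fin 2) (σ₀ : ℤˣ), (nL : ℤ) ≤ (if i = 0 then (nL : ℤ) else (shearUnit nL hL : ℤ)) := fun i σ₀ => by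
    split_ifs
    · exact le_rfl
    · have : ((shearUnit nL hL : ℕ) : ℤ) = nL + (hL.natAbs : ℤ) := by unfold shearUnit; push_cast; ring
      rw [this]; linarith [Int.natCast_nonneg hL.natAbs]
  have hA0 : 0 ≤ P.A := by rw [hA]; positivity
  have hdD : P.d + 2 ≤ shellD P := by omega
  have hr₀2 : 2 ≤ KCmax + Rs := by
    have : 2 ≤ shellD P := by unfold shellD; omega
    nlinarith [hKCmax]
  refine kitClauseAHab' SF Rg (lip_runY hlipφ hσ hnL c₀ hL) ((qStepsN_runY hstep hnL c₀ hL hσ hκL).mono hPN) hlipφ hstep hfr hκ hΔ hδ hℓ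
    hwide hdw hdD hDw hDρ
    (hbelow_of_affine SF haff hU1 P hD1) (habove_of_affine SF haff hU1 P hd1) (hK_of_affine SF haff hU1 P hnL hC hU hKmax)
    (fun i σ₀ z hz _ => hKC_of_affine SF haff hU1 P hnL hC hU hA hKCmax i σ₀ z hz) (hθA_of_affine SF haff hU1 P hA0 hdD) (hAz_of_affine SF haff P hA)
    (hcap_of_affine SF haff hU1 P hD2) (compat_runY hnL c₀ hL hσ) hT hT' hW hR' hRg hRgcard hcU1 hr₀ hr₀2 hR hrs hcS Λc hkn hΛ
    (pexY G φ Q σ) (fun i σ₀ c v hv => ⟨hQRg i σ₀ c hv, ?_⟩) hfull k o Sfin hWD hXD hN hk hpad hfar hnear'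
  rw [hSF]
  exact pexY_spec c₀ hnL hL hσ _ _ Q hA hnS hexRaw hexLev i σ₀ c v hv

end Hab

end Skelφ

end Summit.CriticalPhenomena.PercolationContinuityZ3.Theorems.Transplant

end
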